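import Literature.NumberTheory.GaloisRepresentations.CrystallineDeformationRing
import Mathlib.Analysis.Normed.Module.FiniteDimension
import Mathlib.Analysis.Normed.Group.Ultra
import Mathlib.Analysis.SpecificLimits.Basic
import Mathlib.RingTheory.AdicCompletion.Basic
import HarnessLib

/-!
# The integers of a finite extension of `ℚ_p` inside `ℚ̄_p`: discrete valuation, finite residue field, completeness

Let `L` be an intermediate field of `ℚ̄_p/ℚ_p` (Mathlib `PadicAlgCl p`) which is finite over
`ℚ_p`, and `𝒪_L = intermediateFieldIntegers p L = {x ∈ L : ‖x‖ ≤ 1}` (accepted,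
`CrystallineDeformationRing.lean`) its valuation ring for the restriction of the norm of `ℚ̄_p`.
This file PROVES the standard structure results used by the deformation rings over `𝒪_L`
(Serre, *Local Fields*, Ch. II §1 Prop. 1, §2 Prop. 3 and Cor. 2; Neukirch II (4.8), (5.1)):

* `norm_image_finite_of_pos` — on `{x ∈ L : c ≤ ‖x‖ ≤ 1}` (`c > 0`) the norm takes finitely many
  values (compactness of the unit ball of the finite-dimensional `ℚ_p`-space `L`, ultrametric
  local constancy of the norm);
* `instIsPrincipalIdealRing` — `𝒪_L` is a principal ideal ring (an ideal is generated by an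
  element of maximal norm), hence Noetherian; `uniformizer`, `maximalIdeal_eq_span_uniformizer`,
  `norm_le_norm_uniformizer_of_norm_lt_one` (**the valuation of `L` is discrete**),
  `mem_maximalIdeal_pow_iff`;
* `finite_residueField` — the residue field `k_L = 𝒪_L/λ` is finite;
* `instIsAdicComplete` — `𝒪_L` is `λ`-adically complete (`L` is complete, being
  finite-dimensional over `ℚ_p`).

No named facts, no `sorry`.

## References

* J.-P. Serre, *Local Fields*, GTM 67, Ch. II §1 Prop. 1, §2 Prop. 3 and Cor. 2. [SerreLocalFields1979]
-/

noncomputable section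

open IsLocalRing Metric Filter Topology

namespace Literature.NumberTheory.GaloisRepresentations

namespace intermediateFieldIntegers

variable {p : ℕ} [Fact p.Prime] (L : IntermediateField ℚ_[p] (PadicAlgCl p))

/-! ### Norms, units, the maximal ideal -/

/-- The norm of `L ⊆ ℚ̄_p` is the restriction of the norm of `ℚ̄_p`. [folklore] -/
theorem norm_coe (x : L) : ‖x‖ = ‖(x : PadicAlgCl p)‖ := rfl

/-- `L ⊆ ℚ̄_p` is ultrametric. [folklore] -/
instance instIsUltrametricDist : IsUltrametricDist L :=
  IsUltrametricDist.isUltrametricDist_of_forall_norm_add_le_max_norm fun x y => by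
    rw [norm_coe, norm_coe, norm_coe, IntermediateField.coe_add]
    exact IsUltrametricDist.norm_add_le_max _ _

/-- Membership in `𝒪_L` in terms of the norm of `L`. [folklore] -/
theorem mem_iff_norm_le_one (x : L) : x ∈ intermediateFieldIntegers p L ↔ ‖x‖ ≤ 1 := by
  rw [mem_intermediateFieldIntegers_iff, norm_coe]

/-- Elements of `𝒪_L` have norm at most one. [folklore] -/
theorem norm_le_one (a : intermediateFieldIntegers p L) : ‖(a : L)‖ ≤ 1 :=
  (mem_iff_norm_le_one L _).1 a.2

/-- The valuation defining `𝒪_L` is the norm. [folklore] -/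
theorem valuation_comap_apply (x : L) :
    ((Valued.v : Valuation (PadicAlgCl p) NNReal).comap (algebraMap L (PadicAlgCl p))) x = ‖x‖₊ := by
  rw [Valuation.comap_apply, PadicAlgCl.valuation_def]
  rfl

/-- **The maximal ideal of `𝒪_L` is the open unit ball.** [cite: SerreLocalFields1979, Ch. II §1] -/
theorem mem_maximalIdeal_iff (a : intermediateFieldIntegers p L) :
    a ∈ maximalIdeal (intermediateFieldIntegers p L) ↔ ‖(a : L)‖ < 1 := by
  rw [ValuationSubring.valuation_lt_one_iff,
    ← (Valuation.isEquiv_valuation_valuationSubring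
      ((Valued.v : Valuation (PadicAlgCl p) NNReal).comap (algebraMap L (PadicAlgCl p)))).lt_one_iff_lt_one,
    valuation_comap_apply, ← NNReal.coe_lt_coe, coe_nnnorm, NNReal.coe_one]

/-- **The units of `𝒪_L` are the elements of norm one.** [cite: SerreLocalFields1979, Ch. II §1] -/
theorem isUnit_iff_norm_eq_one (a : intermediateFieldIntegers p L) : IsUnit a ↔ ‖(a : L)‖ = 1 := by
  rw [ValuationSubring.valuation_eq_one_iff,
    ← (Valuation.isEquiv_valuation_valuationSubring
      ((Valued.v : Valuation (PadicAlgCl p) NNReal).comap (algebraMap L (PadicAlgCl p)))).eq_one_iff_eq_one,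
    valuation_comap_apply, ← NNReal.coe_inj, coe_nnnorm, NNReal.coe_one]

/-- `p` lies in the maximal ideal of `𝒪_L`; in particular `𝒪_L` is not a field. [folklore] -/
theorem natCast_mem_maximalIdeal : (p : intermediateFieldIntegers p L) ∈ maximalIdeal (intermediateFieldIntegers p L) := by
  rw [mem_maximalIdeal_iff, norm_coe]
  have h1 : (((p : intermediateFieldIntegers p L) : L) : PadicAlgCl p) = (p : PadicAlgCl p) := by norm_cast
  have h2 : (p : PadicAlgCl p) = algebraMap ℚ_[p] (PadicAlgCl p) (p : ℚ_[p]) := (map_natCast _ p).symm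
  rw [h1, h2, norm_algebraMap', Padic.norm_p]
  exact inv_lt_one_of_one_lt₀ (by exact_mod_cast (Fact.out : p.Prime).one_lt)

/-- `p ≠ 0` in `𝒪_L`. [folklore] -/
theorem natCast_ne_zero : (p : intermediateFieldIntegers p L) ≠ 0 := by
  intro h
  have h1 : (((p : intermediateFieldIntegers p L) : L) : PadicAlgCl p) = 0 := by rw [h]; rfl
  have h2 : (p : PadicAlgCl p) = 0 := by exact_mod_cast h1
  exact (Fact.out : p.Prime).ne_zero (Nat.cast_eq_zero.1 h2)

/-- The maximal ideal of `𝒪_L` is non-zero. [folklore] -/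
theorem maximalIdeal_ne_bot : maximalIdeal (intermediateFieldIntegers p L) ≠ ⊥ := fun h =>
  natCast_ne_zero L ((Submodule.mem_bot _).1 (h ▸ natCast_mem_maximalIdeal L))

/-! ### Compactness of the unit ball and finiteness of norm values -/

variable [FiniteDimensional ℚ_[p] L]

/-- The closed unit ball of `L` is compact (`L` is a finite-dimensional normed space over the
locally compact field `ℚ_p`). [folklore] -/
theorem isCompact_setOf_norm_le_one : IsCompact {x : L | ‖x‖ ≤ 1} := by
  haveI : ProperSpace L := FiniteDimensional.proper ℚ_[p] L
  have : {x : L | ‖x‖ ≤ 1} = closedBall 0 1 := by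
    ext x
    simp
  rw [this]
  exact isCompact_closedBall 0 1

/-- **Finiteness of norm values on an annulus**: on `{x ∈ L : c ≤ ‖x‖ ≤ 1}` (`c > 0`) the norm takes
only finitely many values (the norm is locally constant away from `0` and the annulus is compact).
This is the discreteness of the valuation of the finite extension `L/ℚ_p`.
[cite: SerreLocalFields1979, Ch. II §2 Cor. 2] -/
theorem norm_image_finite_of_pos {c : ℝ} (hc : 0 < c) :
    ((fun x : L => ‖x‖) '' {x : L | c ≤ ‖x‖ ∧ ‖x‖ ≤ 1}).Finite := by
  set A : Set L := {x : L | c ≤ ‖x‖ ∧ ‖x‖ ≤ 1} with hA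
  have hAc : IsCompact A :=
    (isCompact_setOf_norm_le_one L).of_isClosed_subset
      ((isClosed_le continuous_const continuous_norm).inter (isClosed_le continuous_norm continuous_const))
      fun x hx => hx.2
  obtain ⟨t, ht⟩ := hAc.elim_finite_subcover (fun x : L => ball x c) (fun _ => isOpen_ball)
    fun x _ => Set.mem_iUnion.2 ⟨x, mem_ball_self hc⟩
  refine (t.finite_toSet.image fun x : L => ‖x‖).subset ?_
  rintro _ ⟨y, hy, rfl⟩
  obtain ⟨x, hxt, hyx⟩ := Set.mem_iUnion₂.1 (ht hy)
  refine ⟨x, hxt, ?_⟩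
  -- `‖y - x‖ < c ≤ ‖y‖` forces `‖x‖ = ‖y‖`
  rw [mem_ball, dist_eq_norm] at hyx
  have hne : ‖y‖ ≠ ‖x - y‖ := by
    rw [norm_sub_rev]
    exact (ne_of_gt (hyx.trans_le hy.1))
  have h := IsUltrametricDist.norm_add_eq_max_of_norm_ne_norm hne
  rw [add_sub_cancel, max_eq_left (by rw [norm_sub_rev]; exact (hyx.trans_le hy.1).le)] at h
  exact h

/-! ### `𝒪_L` is a principal ideal ring -/

/-- **`𝒪_L` is a principal ideal ring**: a non-zero ideal is generated by any of its elements of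
maximal norm (which exist by `norm_image_finite_of_pos`). [cite: SerreLocalFields1979, Ch. II §1 Prop. 1] -/
instance instIsPrincipalIdealRing : IsPrincipalIdealRing (intermediateFieldIntegers p L) := by
  refine ⟨fun I => ?_⟩
  by_cases hI : I = ⊥
  · rw [hI]; exact bot_isPrincipal
  obtain ⟨x₀, hx₀I, hx₀⟩ := Submodule.exists_mem_ne_zero_of_ne_bot hI
  set c : ℝ := ‖(x₀ : L)‖ with hc
  have hc0 : 0 < c := norm_pos_iff.2 fun h => hx₀ (Subtype.ext h)
  set T : Set ℝ := (fun a : intermediateFieldIntegers p L => ‖(a : L)‖) '' {a | a ∈ I ∧ c ≤ ‖(a : L)‖} with hT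
  have hTfin : T.Finite := by
    refine (norm_image_finite_of_pos L hc0).subset ?_
    rintro _ ⟨a, ⟨-, hca⟩, rfl⟩
    exact ⟨(a : L), ⟨hca, norm_le_one L a⟩, rfl⟩
  have hcT : c ∈ T := ⟨x₀, ⟨hx₀I, le_rfl⟩, rfl⟩
  obtain ⟨r, hrT, hrmax⟩ := hTfin.toFinset.exists_max_image id ⟨c, hTfin.mem_toFinset.2 hcT⟩
  obtain ⟨a, ⟨haI, hca⟩, rfl⟩ := hTfin.mem_toFinset.1 hrT
  have ha0 : (a : L) ≠ 0 := fun h => by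
    rw [h, norm_zero] at hca
    exact absurd hca (not_le.2 hc0)
  refine ⟨⟨a, le_antisymm (fun b hbI => ?_) ((Ideal.span_singleton_le_iff_mem _).2 haI)⟩⟩
  -- `‖b‖ ≤ ‖a‖`, so `b / a ∈ 𝒪_L`
  have hba : ‖(b : L)‖ ≤ ‖(a : L)‖ := by
    by_cases hcb : c ≤ ‖(b : L)‖
    · exact hrmax _ (hTfin.mem_toFinset.2 ⟨b, ⟨hbI, hcb⟩, rfl⟩)
    · exact ((not_le.1 hcb).le).trans hca
  have hq : (b : L) / (a : L) ∈ intermediateFieldIntegers p L := by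
    rw [mem_iff_norm_le_one, norm_div]
    exact div_le_one_of_le₀ hba (norm_nonneg _)
  refine Ideal.mem_span_singleton'.2 ⟨⟨(b : L) / (a : L), hq⟩, Subtype.ext ?_⟩
  change (b : L) / (a : L) * (a : L) = (b : L)
  rw [div_mul_cancel₀ _ ha0]

/-- **A uniformizer `ϖ_L`**: a generator of the (principal, non-zero) maximal ideal of `𝒪_L`.
[cite: SerreLocalFields1979, Ch. II §1] -/
def uniformizer : intermediateFieldIntegers p L :=
  Submodule.IsPrincipal.generator (maximalIdeal (intermediateFieldIntegers p L))

/-- `𝔪 = (ϖ_L)`. [folklore] -/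
theorem maximalIdeal_eq_span_uniformizer :
    maximalIdeal (intermediateFieldIntegers p L) = Ideal.span {uniformizer L} :=
  (Ideal.span_singleton_generator _).symm

/-- `‖ϖ_L‖ < 1`. [folklore] -/
theorem norm_uniformizer_lt_one : ‖(uniformizer L : L)‖ < 1 :=
  (mem_maximalIdeal_iff L _).1 (Submodule.IsPrincipal.generator_mem _)

/-- `ϖ_L ≠ 0`. [folklore] -/
theorem uniformizer_ne_zero : uniformizer L ≠ 0 := by
  intro h
  apply maximalIdeal_ne_bot L
  rw [maximalIdeal_eq_span_uniformizer, h, Ideal.span_singleton_eq_bot]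

/-- `0 < ‖ϖ_L‖`. [folklore] -/
theorem norm_uniformizer_pos : 0 < ‖(uniformizer L : L)‖ :=
  norm_pos_iff.2 fun h => uniformizer_ne_zero L (Subtype.ext h)

/-- **Discreteness**: every `x ∈ L` with `‖x‖ < 1` has `‖x‖ ≤ ‖ϖ_L‖`. [cite: SerreLocalFields1979, Ch. II §2 Cor. 2] -/
theorem norm_le_norm_uniformizer_of_norm_lt_one {x : L} (hx : ‖x‖ < 1) : ‖x‖ ≤ ‖(uniformizer L : L)‖ := by
  have hxO : x ∈ intermediateFieldIntegers p L := (mem_iff_norm_le_one L x).2 hx.le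
  have hxm : (⟨x, hxO⟩ : intermediateFieldIntegers p L) ∈ maximalIdeal (intermediateFieldIntegers p L) :=
    (mem_maximalIdeal_iff L _).2 hx
  rw [maximalIdeal_eq_span_uniformizer, Ideal.mem_span_singleton'] at hxm
  obtain ⟨q, hq⟩ := hxm
  have hx' : x = (q : L) * (uniformizer L : L) :=
    (congrArg (fun z : intermediateFieldIntegers p L => (z : L)) hq).symm
  rw [hx', norm_mul]
  exact mul_le_of_le_one_left (norm_nonneg _) (norm_le_one L q)

/-- **Membership in `𝔪ⁿ`**: `a ∈ 𝔪ⁿ ↔ ‖a‖ ≤ ‖ϖ_L‖ⁿ`. [folklore] -/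
theorem mem_maximalIdeal_pow_iff (n : ℕ) (a : intermediateFieldIntegers p L) :
    a ∈ maximalIdeal (intermediateFieldIntegers p L) ^ n ↔ ‖(a : L)‖ ≤ ‖(uniformizer L : L)‖ ^ n := by
  rw [maximalIdeal_eq_span_uniformizer, Ideal.span_singleton_pow, Ideal.mem_span_singleton']
  constructor
  · rintro ⟨q, rfl⟩
    change ‖(q : L) * (uniformizer L : L) ^ n‖ ≤ _
    rw [norm_mul, norm_pow]
    exact mul_le_of_le_one_left (pow_nonneg (norm_nonneg _) _) (norm_le_one L q)
  · intro h
    have hϖ : ((uniformizer L : L)) ^ n ≠ 0 := pow_ne_zero _ fun h0 => uniformizer_ne_zero L (Subtype.ext h0)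
    have hq : (a : L) / (uniformizer L : L) ^ n ∈ intermediateFieldIntegers p L := by
      rw [mem_iff_norm_le_one, norm_div, norm_pow]
      exact div_le_one_of_le₀ h (pow_nonneg (norm_nonneg _) _)
    refine ⟨⟨_, hq⟩, Subtype.ext ?_⟩
    change (a : L) / (uniformizer L : L) ^ n * (uniformizer L : L) ^ n = (a : L)
    rw [div_mul_cancel₀ _ hϖ]

/-- Norm bound for differences congruent modulo `𝔪ⁿ`. [folklore] -/
theorem norm_sub_le_of_sub_mem_pow {n : ℕ} {a b : intermediateFieldIntegers p L}
    (h : a - b ∈ maximalIdeal (intermediateFieldIntegers p L) ^ n) :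
    ‖(a : L) - (b : L)‖ ≤ ‖(uniformizer L : L)‖ ^ n := by
  have := (mem_maximalIdeal_pow_iff L n (a - b)).1 h
  exact this

/-! ### Finite residue field -/

/-- **The residue field `k_L = 𝒪_L/(ϖ_L)` is finite** (the compact unit ball is covered by finitely
many open unit balls, i.e. residue classes). [cite: SerreLocalFields1979, Ch. II §1 Prop. 1] -/
theorem finite_residueField : Finite (ResidueField (intermediateFieldIntegers p L)) := by
  classical
  obtain ⟨t, ht⟩ := (isCompact_setOf_norm_le_one L).elim_finite_subcover (fun x : L => ball x 1)
    (fun _ => isOpen_ball) fun x _ => Set.mem_iUnion.2 ⟨x, mem_ball_self one_pos⟩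
  let f : t → ResidueField (intermediateFieldIntegers p L) := fun x =>
    residue _ (if hx : ‖((x : L))‖ ≤ 1 then ⟨x, (mem_iff_norm_le_one L _).2 hx⟩ else 0)
  refine Finite.of_surjective f fun y => ?_
  obtain ⟨a, rfl⟩ := Ideal.Quotient.mk_surjective y
  obtain ⟨x, hxt, hax⟩ := Set.mem_iUnion₂.1 (ht (norm_le_one L a))
  rw [mem_ball, dist_eq_norm] at hax
  have hx1 : ‖x‖ ≤ 1 := by
    have h := IsUltrametricDist.norm_add_le_max ((a : L)) (x - (a : L))
    rw [add_sub_cancel] at h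
    refine h.trans (max_le (norm_le_one L a) ?_)
    rw [norm_sub_rev]; exact hax.le
  refine ⟨⟨x, hxt⟩, ?_⟩
  simp only [f, dif_pos hx1]
  change Ideal.Quotient.mk _ _ = Ideal.Quotient.mk _ _
  rw [Ideal.Quotient.eq, mem_maximalIdeal_iff]
  change ‖x - (a : L)‖ < 1
  rw [norm_sub_rev]
  exact hax

/-! ### `λ`-adic completeness -/

/-- **`𝒪_L` is `λ`-adically complete** (and separated): `L` is complete and `𝔪ⁿ = {‖x‖ ≤ ‖ϖ_L‖ⁿ}`.
[cite: SerreLocalFields1979, Ch. II §2 Prop. 3] -/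
instance instIsAdicComplete : IsAdicComplete (maximalIdeal (intermediateFieldIntegers p L)) (intermediateFieldIntegers p L) where
  haus' x hx := by
    have hle : ∀ n : ℕ, ‖(x : L)‖ ≤ ‖(uniformizer L : L)‖ ^ n := fun n => by
      have h := hx n
      rw [SModEq.zero, smul_eq_mul, Ideal.mul_top] at h
      exact (mem_maximalIdeal_pow_iff L n x).1 h
    have h0 : ‖(x : L)‖ ≤ 0 :=
      ge_of_tendsto (tendsto_pow_atTop_nhds_zero_of_lt_one (norm_nonneg _) (norm_uniformizer_lt_one L))
        (Eventually.of_forall hle)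
    exact Subtype.ext (norm_le_zero_iff.1 h0)
  prec' f hf := by
    haveI : CompleteSpace L := FiniteDimensional.complete ℚ_[p] L
    set r : ℝ := ‖(uniformizer L : L)‖ with hr
    have hdist : ∀ {m n : ℕ}, m ≤ n → ‖((f n : intermediateFieldIntegers p L) : L) - (f m : L)‖ ≤ r ^ m := by
      intro m n hmn
      have h := hf hmn
      rw [SModEq.sub_mem, smul_eq_mul, Ideal.mul_top] at h
      rw [norm_sub_rev]
      exact norm_sub_le_of_sub_mem_pow L h
    have hcau : CauchySeq fun n => ((f n : intermediateFieldIntegers p L) : L) := by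
      refine Metric.cauchySeq_iff'.2 fun ε hε => ?_
      obtain ⟨N, hN⟩ := exists_pow_lt_of_lt_one hε (norm_uniformizer_lt_one L)
      exact ⟨N, fun n hn => by rw [dist_eq_norm]; exact (hdist hn).trans_lt hN⟩
    obtain ⟨x, hx⟩ := cauchySeq_tendsto_of_complete hcau
    have hx1 : ‖x‖ ≤ 1 :=
      isClosed_le continuous_norm continuous_const |>.mem_of_tendsto hx
        (Eventually.of_forall fun n => norm_le_one L (f n))
    refine ⟨⟨x, (mem_iff_norm_le_one L x).2 hx1⟩, fun n => ?_⟩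
    rw [SModEq.sub_mem, smul_eq_mul, Ideal.mul_top, mem_maximalIdeal_pow_iff]
    change ‖((f n : intermediateFieldIntegers p L) : L) - x‖ ≤ r ^ n
    have hlim : Tendsto (fun m => ‖((f n : intermediateFieldIntegers p L) : L) - (f m : L)‖) atTop
        (𝓝 ‖((f n : intermediateFieldIntegers p L) : L) - x‖) :=
      (tendsto_const_nhds.sub hx).norm
    exact le_of_tendsto hlim (eventually_atTop.2 ⟨n, fun m hm => by
      rw [norm_sub_rev]; exact hdist hm⟩)

end intermediateFieldIntegers

end Literature.NumberTheory.GaloisRepresentations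

end
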